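/- Copyright: the b2b-balaban cell (near-miss cell 7), T⁴-continuum fan-out, NE7b crux team (2), leaf lineage
t4-ne7b-formalise-leaf-05 on the owner's INTERFACE REQUEST NE7b IR-41-7 (ii).  Released under the licence of the
surrounding project. -/
import Summits.QuantumFields.BalabanUV.T4Continuum.Support.HistoryGenealogyInstantiateMClauses
import Summits.QuantumFields.BalabanUV.T4Continuum.Support.HistoryGenealogyInstantiateSanity

/-!
# INSTANTIATION FROM THE LEVEL SETS, MEMORY-GENERIC PROCESS — SANITY (IR-41-7 (ii)): non-vacuity of the memory-generic
construction at level `0`, and the two memory instances (M-twin of row S15's `HistoryGenealogyInstantiateSanity`;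
INTERFACE REQUEST NE7b IR-41-7 (ii) of the row-NE7b OWNER t4-ne7b-p1 gen 41; filed by leaf lineage
t4-ne7b-formalise-leaf-05 — PRE-POSITIONING ONLY)

Summits-side support leaf of the T⁴-continuum cell (rung (B)+1 on a FINITE torus only; NOT infinite volume, NOT the
mass gap, NOT the Clay statement; NOT a proof of the spine estimate NE7b, which is the cell's OWN estimate, NOT PRINTED
and NOT PROVED).  [folklore] finite combinatorics over bricks 3-M∕3b-M∕4-M (`RunInputM.StM`, `histM`, `rnwM`,
`constitM_block_inr`, `levelClausesW_histM`, `realisesW_histM`) and row S15's sanity lemmas (`tcomps_singleton` —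
REUSED); nothing printed is asserted, zero `sorry`.

WHAT IS PROVED.  §1 with `N 0 = {n}`: `vertM_zero`, `blocksM_zero_singleton`, `newLineM_zero_inr`,
**`StM_zero_singleton`** (the live lines at level `0` = the single new region as the event line `(n.2, 0, n.2)`),
`compM_zero_singleton`, `constitM_zero_singleton`, **`pgenRM_zero_singleton`** (its extracted pedigree is the BIRTH of the
region) — the memory-generic construction is NON-VACUOUS.  §2 THE TWO MEMORY INSTANCES: `ofFrozen J` (`Rm t _ := R t`,
the landed S15 process) and `ofCurrent J` (`Rm t k := R (t + k)`, print's current memory, B16 p. 384 «with N = R_j»,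
B15 p. 177) with their DOMINATION lemmas `rm_le_ofFrozen` (by `le_rfl`) and `rm_le_ofCurrent` (from `R` non-increasing —
a displayed T-class hypothesis, [B14] p. 245 ∕ [B15] p. 177, never asserted), and the corresponding instances of
`levelClausesW_histM` ∕ `realisesW_histM`: **`realisesW_histM_frozen`**, **`realisesW_histM_current`**.

HONEST.  Proves nothing of Bałaban's; NE7b NOT proved; spine 0∕9.  HONEST DEPENDENCY (cell): continuum YM on T⁴ ⇐
BetaPertH ∧ nine spine estimates (0/9 proved); BetaPertH ⇐ (D1) ∧ (D4) ∧ CAP+tail; G-an2-4 gates asym, D1 and NE2/3/4.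
This file changes none of it. -/

open Finset
open Literature.MathematicalPhysics.QuantumFieldTheory.Balaban1983to89
open Literature.MathematicalPhysics.QuantumFieldTheory.Balaban1983to89.B13ScaleTransfer
open Literature.MathematicalPhysics.QuantumFieldTheory.Balaban1983to89.B16MergeGeometry
open Summit.QuantumFields.BalabanUV.T4Continuum.HistoryAdmissible
open Summit.QuantumFields.BalabanUV.T4Continuum.HistoryRealise
open Summit.QuantumFields.BalabanUV.T4Continuum.HistoryRealiseWeak
open Summit.QuantumFields.BalabanUV.T4Continuum.HistoryRealiseMemory
open Summit.QuantumFields.BalabanUV.T4Continuum.HistoryGenealogyExtraction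
open Summit.QuantumFields.BalabanUV.T4Continuum.HistoryGenealogyRealise
open Summit.QuantumFields.BalabanUV.T4Continuum.HistoryTouchComponents

namespace Summit.QuantumFields.BalabanUV.T4Continuum.HistoryGenealogyInstantiate

noncomputable section

open Classical

variable {d : ℕ}

/-! ## §1 Level `0` with a single new region, memory-generic process -/

namespace RunInputM

variable (I : RunInputM d) {n : Lab d} (hn : I.N 0 = {n})
include hn

/-- the vertices at level `0`: the one new region [folklore] -/
theorem vertM_zero : I.vertM 0 (I.PrevM 0) = {Sum.inr n} := by
  simp [vertM, PrevM, hn]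

/-- the blocksM at level `0`: the one block [folklore] -/
theorem blocksM_zero_singleton : I.blocksM 0 (I.PrevM 0) = {{Sum.inr n}} := by
  rw [blocksM, I.vertM_zero hn, tcomps_singleton]

omit hn in
/-- the new line of a lone new region at level `0` is the event line `(region, 0, region)` [folklore] -/
theorem newLineM_zero_inr (m : Lab d) : I.newLineM 0 {Sum.inr m} = ⟨m.2, 0, m.2⟩ := by
  have hnone : I.loneOldM 0 {Sum.inr m} = none := by
    by_contra h
    obtain ⟨τ, hτ⟩ := Option.ne_none_iff_exists'.1 h
    obtain ⟨hT, -⟩ := I.eq_of_loneOldM_eq_some hτ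
    have : (Sum.inr m : Line d ⊕ Lab d) ∈ ({Sum.inl τ} : Finset (Line d ⊕ Lab d)) := by
      rw [← hT]; exact Finset.mem_singleton_self _
    simp at this
  unfold newLineM
  rw [hnone]
  simp [RunInput.P]

/-- **THE LIVE LINES AT LEVEL `0`**: the single new region, as the event line `(n.2, 0, n.2)`. [folklore] -/
theorem StM_zero_singleton : I.StM 0 = {⟨n.2, 0, n.2⟩} := by
  rw [StM_eq_formM, formM, I.blocksM_zero_singleton hn, Finset.image_singleton, I.newLineM_zero_inr]

/-- the components of level `0`: the one label `(0, n.2)` [folklore] -/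
theorem compM_zero_singleton : I.histM.comp 0 = {lab ⟨n.2, 0, n.2⟩} := by
  show (I.StM 0).image lab = _
  rw [I.StM_zero_singleton hn, Finset.image_singleton]

/-- its constituent list: the one new region (under `NewOK`) [folklore] -/
theorem constitM_zero_singleton (hN : I.NewOK) : I.histM.constit 0 (lab ⟨n.2, 0, n.2⟩) = [Sum.inr n] := by
  have hT : ({Sum.inr n} : Finset (Line d ⊕ Lab d)) ∈ I.blocksM 0 (I.PrevM 0) := by
    rw [I.blocksM_zero_singleton hn]; exact Finset.mem_singleton_self _
  have hlab : lab (I.newLineM 0 {Sum.inr n}) = lab (⟨n.2, 0, n.2⟩ : Line d) := by rw [I.newLineM_zero_inr]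
  rw [← hlab]
  exact I.constitM_block_inr hN hT rfl

/-- **THE EXTRACTED PEDIGREE of the level-`0` component is the BIRTH of the region** (under `NewOK`). [folklore] -/
theorem pgenRM_zero_singleton (hN : I.NewOK) :
    I.histM.pgenR I.rnwM 0 (lab ⟨n.2, 0, n.2⟩) = PGen.birth 0 (I.cls n) n :=
  I.histM.pgenR_zero_birth I.rnwM _ _ (I.constitM_zero_singleton hn hN)


end RunInputM

/-! ## §2 The two memory instances and their domination -/

namespace RunInputM

/-- the FROZEN-memory instance of a run input: `Rm t _ := R t` (row S15's process) [folklore] -/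
def ofFrozen (J : RunInput d) : RunInputM d := ⟨J, fun t _ => J.R t⟩

/-- the CURRENT-memory instance of a run input: `Rm t k := R (t + k)` (print's «with N = R_j» at the level the test
is made) [folklore] -/
def ofCurrent (J : RunInput d) : RunInputM d := ⟨J, fun t k => J.R (t + k)⟩

/-- readiness of the frozen instance is row S15's `Rdy` [folklore] -/
theorem rdyM_ofFrozen_iff (J : RunInput d) (j : ℕ) (τ : Line d) : (ofFrozen J).RdyM j τ ↔ J.Rdy j τ := Iff.rfl

/-- readiness of the current instance is the current-memory stop `StopsCur` of IR-41-2 [folklore] -/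
theorem rdyM_ofCurrent_iff (J : RunInput d) (j : ℕ) (τ : Line d) :
    (ofCurrent J).RdyM j τ ↔ StopsCur J.L J.s J.R τ.t τ.E (j - τ.t) := Iff.rfl

/-- domination for the frozen instance (equality) [folklore] -/
theorem rm_le_ofFrozen (J : RunInput d) : ∀ t k, (ofFrozen J).Rm t k ≤ (ofFrozen J).R t := fun _ _ => le_rfl

/-- domination for the current instance from NON-INCREASING sizes `R` (displayed, T-class: «in some steps the number
R_k decreases by the factor L^{−1}», never increases) [folklore] -/
theorem rm_le_ofCurrent (J : RunInput d) (hR : ∀ a b, a ≤ b → J.R b ≤ J.R a) :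
    ∀ t k, (ofCurrent J).Rm t k ≤ (ofCurrent J).R t := fun t k => hR t (t + k) (Nat.le_add_right t k)

/-- **THE FROZEN INSTANCE: every component weakly realised** (row S15's conclusion, re-derived through the M-bricks;
under `NewOK` only). [folklore] -/
theorem realisesW_histM_frozen (J : RunInput d) (hN : (ofFrozen J).NewOK) {ℓ : ℕ} {c : Lab d}
    (hc : c ∈ (ofFrozen J).histM.comp ℓ) :
    RealisesW J.L J.s J.R ((ofFrozen J).histM.pgenR (ofFrozen J).rnwM ℓ c)
      (GeomHistoryR.edomR (ofFrozen J).histM (ofFrozen J).rnwM RunInput.domL ℓ c) :=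
  ((ofFrozen J).realisesW_histM hN (rm_le_ofFrozen J) hc).1

/-- **THE CURRENT-MEMORY INSTANCE (print's readiness reading): every component weakly realised**, under `NewOK` and
non-increasing sizes `R`. [folklore] -/
theorem realisesW_histM_current (J : RunInput d) (hN : (ofCurrent J).NewOK) (hR : ∀ a b, a ≤ b → J.R b ≤ J.R a)
    {ℓ : ℕ} {c : Lab d} (hc : c ∈ (ofCurrent J).histM.comp ℓ) :
    RealisesW J.L J.s J.R ((ofCurrent J).histM.pgenR (ofCurrent J).rnwM ℓ c)
      (GeomHistoryR.edomR (ofCurrent J).histM (ofCurrent J).rnwM RunInput.domL ℓ c) :=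
  ((ofCurrent J).realisesW_histM hN (rm_le_ofCurrent J hR) hc).1

end RunInputM

end

end Summit.QuantumFields.BalabanUV.T4Continuum.HistoryGenealogyInstantiate
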